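import Mathlib
import HarnessLib
import Literature.AlgebraicGeometry.Ramification.InertiaNormalSylow

/-!
# Inertia groups shrink along equivariant morphisms (crux `WildQuotients.WildQuotientResolution`, line `Sketch`)

Stub `stub_inertia_le` of the skeleton `Sketch` for crux stmt-ResolutionOfSingularities-15640
(route `ResolutionOfSingularities/WildQuotients`, card `p-closure-sylow-separation`): for actions
`σ` of `G` on `X` and `τ` of `G` on `Y` and a `G`-equivariant morphism `π : X ⟶ Y`
(`σ g ≫ π = π ≫ τ g`), the inertia group (Abbes–Saito 2011, 2.4; the tree's
`Literature.AlgebraicGeometry.Ramification.inertiaSubgroup`) of a point `x ∈ X` is contained in the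
inertia group of its image `π x ∈ Y` — the group-theoretic shadow, upstairs, of AS2011 Lemma 2.15,
used in Phase 0 ("Sylow separation") of the wild-quotient resolution to see that inertia groups never
grow along the equivariant blow-ups `X♯ → X′`.

Proof. Let `g ∈ I_x`, i.e. `Spec κ(x) → X` is fixed by `σ g`. The canonical point of `π x`
receives the epimorphism `Spec κ(x) → Spec κ(π x)` (`epi_SpecMap_residueField`: flat and surjective),
and `Spec κ(x) → Spec κ(π x) → Y` is `Spec κ(x) → X → Y`
(`Scheme.Hom.SpecMap_residueFieldMap_fromSpecResidueField`); composing with `τ g` and using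
equivariance, `Spec κ(x) → X —σ g→ X → Y = Spec κ(x) → X → Y`, so after cancelling the epimorphism
`Spec κ(π x) → Y` is fixed by `τ g`.
-/

-- single-problem summit: the doubled namespace component `ResolutionOfSingularities` is forced
set_option linter.dupNamespace false

namespace Summit.ResolutionOfSingularities.ResolutionOfSingularities.Theorems.WildQuotientResolution.InertiaLe

open CategoryTheory AlgebraicGeometry Literature.AlgebraicGeometry.Ramification

/-- **Inertia groups shrink along equivariant morphisms** (AS2011 Lemma 2.15's group-theoretic
shadow, upstairs): for actions `σ` on `X`, `τ` on `Y` and a `G`-equivariant `π : X ⟶ Y`, the inertia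
group of `x` is contained in that of `π x` (compose `Spec κ(x) → X → Y` and cancel the epimorphism
`Spec κ(x) → Spec κ(π x)`). [folklore; cf. AbbesSaito2011, Lemma 2.15] -/
theorem stub_inertia_le {G : Type} [Group G] {X Y : Scheme.{0}} (σ : G →* Aut X) (τ : G →* Aut Y)
    (π : X ⟶ Y) (hπ : ∀ g : G, (σ g).hom ≫ π = π ≫ (τ g).hom) (x : X) :
    inertiaSubgroup σ x ≤ inertiaSubgroup τ (π.base x) := by
  intro g hg
  rw [mem_inertiaSubgroup_iff] at hg ⊢
  haveI := epi_SpecMap_residueField (Y := Y) (π.base x) (π.residueFieldMap x)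
  rw [← cancel_epi (Spec.map (π.residueFieldMap x)),
    Scheme.Hom.SpecMap_residueFieldMap_fromSpecResidueField_assoc,
    Scheme.Hom.SpecMap_residueFieldMap_fromSpecResidueField, ← hπ g, ← Category.assoc, hg]

end Summit.ResolutionOfSingularities.ResolutionOfSingularities.Theorems.WildQuotientResolution.InertiaLe
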